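import Summits.Ventures.DiscreteObjects.Hadamard.InvertingInvolutionWindows668
import Summits.Ventures.DiscreteObjects.Hadamard.PrimeOrderFixedRows668

/-!
# H(668): involutions inverting an element of order 23 with one fixed row are never nega — they fix 4, 12, 20 or 28 rows
# (kernel window; corollary of the uniform count of `InvertingInvolutionWindows668`)

Framing: lottery ticket; floor = certified bounds/negative ranges.

Cell pub-namedobj (venture DiscreteObjects), target (H), hadamard gen 22.  By the census (gen 6–9, `hadamard668_signedAut_fixedRows`)
a signed automorphism `σ = (π, κ, d, e)` of an H(668) with `π^23 = κ^23 = 1`, `(π, κ) ≠ (1,1)` fixes `1 + 1` or `24 + 24` rows and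
columns.  In the first type (`1` fixed row, `29` orbits of length `23`; only the row permutation `π` with `π²³ = 1` and ONE fixed
row enters the statement), a signed automorphism `ρ = (π', κ', d', e')` with involution pair whose row part INVERTS `π` (`μ ≡ 22 (mod 23)`) maps
`Fix σ = {r}` to itself, hence FIXES `r`: it is not fixed-point-free, so by the involution census (gen 13) it is of type I, and
the uniform count (`f = 1 + m`, `m ≤ 29`) leaves **`#Fix ρ ∈ {4, 12, 20, 28}`** (`hadamard668_order23_type1_inverting_involution`).
WINDOW / STRUCTURE of a hypothetical object; nothing excluded; H(668) untouched; HITS 0/4.  Ours; no `sorry`, no definitions,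
default heartbeats.
-/

namespace Summit.Ventures.DiscreteObjects.Hadamard

open Finset BigOperators Matrix

open Literature.Combinatorics.Designs.GoethalsSeidel (IsHadamardMatrix)

variable {ι : Type*} [Fintype ι] [DecidableEq ι]

/-- **Involutions inverting an element of order 23 of fixed type `1` fix `4, 12, 20` or `28` rows (as many columns), among them
the `σ`-fixed row; they are never nega.** -/
theorem hadamard668_order23_type1_inverting_involution {H : Matrix ι ι ℤ} (hH : IsHadamardMatrix H)
    (hι : Fintype.card ι = 668) {π π' κ' : Equiv.Perm ι} {d' e' : ι → ℤ}
    (hπ : π ^ 23 = 1) (hfix : (univ.filter fun x => π x = x).card = 1)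
    (haut' : IsSignedAut H π' κ' d' e') {μ : ℕ} (hnπ : π' * π = π ^ μ * π')
    (hμ : μ % 23 = 22) (h2 : π' ^ 2 = 1) (h2' : κ' ^ 2 = 1) (hne' : π' ≠ 1 ∨ κ' ≠ 1) :
    (univ.filter fun x => π' x = x).card = (univ.filter fun y => κ' y = y).card ∧
    ((univ.filter fun x => π' x = x).card = 4 ∨ (univ.filter fun x => π' x = x).card = 12 ∨
      (univ.filter fun x => π' x = x).card = 20 ∨ (univ.filter fun x => π' x = x).card = 28) ∧
    (∀ x, π x = x → π' x = x) := by
  have p23 : Nat.Prime 23 := by norm_num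
  have hclπ := card_fixed_add_classes π p23 hπ
  rw [hfix, hι] at hclπ
  have hcπ : (blockClasses π 23).card = 29 := by omega
  obtain ⟨f₀, m, j, hj, hm, hf, -, hfixed⟩ := inverting_involution_count_prime p23 hnπ hπ (by norm_num) hμ h2
  rw [hfix] at hj hfixed
  rw [hcπ] at hm
  have hf₀ : f₀ = 1 := by omega
  obtain ⟨-, -, hcases⟩ := hadamard668_involution_census_final hH hι π' κ' d' e' haut' h2 h2' hne'
  rcases hcases with ⟨heq, hmod8, h4, -, -⟩ | ⟨h0, -, -, -⟩
  · exact ⟨heq, by omega, hfixed hf₀⟩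
  · exfalso; omega

end Summit.Ventures.DiscreteObjects.Hadamard
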